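import Literature.Combinatorics.SimpleGraph.SubtreeHelly
import Literature.Combinatorics.SimpleGraph.TreeDecomposition
import Literature.Combinatorics.SimpleGraph.WallTopologicalMinor
import HarnessLib

/-!
# Brambles bound the tree-width from below; the tree-width of the grid; monotonicity

Topic `Literature/Combinatorics/SimpleGraph`. Three standard facts about tree-width
(`Literature.Combinatorics.SimpleGraph.treewidth`, `TreeDecomposition`) that the tree lacked —
`TreewidthDuality.lean` proves only the hard direction (tree-width `≥ k` ⇒ a bramble of order `> k`)
of Seymour–Thomas's duality theorem; here is the easy converse, with its two classical companions:

* **`treewidth_le_of_hom_injective`** [Diestel2010, Lemma 12.3.1] —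
  (for every `H ⊆ G`, `(T, (V_t ∩ V(H))_{t ∈ T})` is a tree-decomposition of `H`): pulling a tree
  decomposition back along an injective homomorphism; tree-width is monotone under subgraph
  embeddings.
* `TreeDecomposition.exists_bag_covers`, **`le_treewidth_of_isBramble`** [Diestel2010, Thm. 12.3.6,
  easy direction (§12.3, Exercise 17); BondyMurty2008, §10.5, p. 234] — (if every two sets in `𝒞`
  touch, we can find a `t ∈ T` such that `V_t` covers `𝒞`): for a connected vertex set `B` the tree
  vertices whose bags meet `B` form a subtree, touching sets give meeting subtrees, and the Helly
  property of subtrees (`IsTree.helly`, `SubtreeHelly.lean`) yields a bag meeting every member of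
  the bramble; hence a bramble not covered by `≤ k` vertices forces `tw ≥ k`.
* `isBramble_crosses`, **`min_le_treewidth_grid`** [BondyMurty2008, §10.5, Fig. 10.30
  (the bramble of crosses of the grid)] — the crosses (row `i` ∪ column `j`) of the
  `(a+1) × (b+1)` grid `grid a b` (`WallTopologicalMinor.lean`: `pathGraph (a+1) □ pathGraph (b+1)`)
  form a bramble which no `min a b` vertices cover (a smaller set misses a row and a column), so
  `min a b ≤ tw(grid a b)`.

Used by `Literature/Computability/AlgebraicComplexity/BDI20TableauTreewidthLowerBound.lean`
(Bläser–Dörfler–Ikenmeyer Prop 7.5 (2): two-row tableau graphs of tree-width `Ω(√n)`).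

## References
* [Diestel2010] R. Diestel, *Graph Theory*, 4th ed., GTM 173 (2010), §12.3: Lemma 12.3.1,
  Thm. 12.3.6 (Seymour & Thomas 1993) with the remark before it (Exercise 17); held text
  `book:diestel2010-graph-theory` p0220.txt:L1, p0222.txt:L1-5.
* [BondyMurty2008] J. A. Bondy, U. S. R. Murty, *Graph Theory*, GTM 244 (2008), §10.5 Brambles
  (pp. 233–234: transversal, order, Fig. 10.30: a bramble of order four in the (3 × 3)-grid; the
  Helly proof that the bramble number is at most the tree-width, Thm. 10.41); held text
  `book:bondy2008-graph-theory` p0233.txt:L5-13, p0234.txt:L1-7.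
-/

namespace Literature.Combinatorics.SimpleGraph

open _root_.SimpleGraph

variable {V : Type*} {G : _root_.SimpleGraph V}

/-! ### Monotonicity of treewidth under subgraph embeddings -/

/-- **Tree-width is monotone under subgraph embeddings**: if `G` maps injectively and
adjacency-preservingly into `H` (i.e. `G` is isomorphic to a subgraph of `H`), then
`tw(G) ≤ tw(H)`. [cite: Diestel2010, Lemma 12.3.1] -/
theorem treewidth_le_of_hom_injective {W : Type*} [Fintype V] [Fintype W] [DecidableEq W]
    {H : _root_.SimpleGraph W} (f : G →g H) (hf : Function.Injective f) :
    treewidth G ≤ treewidth H := by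
  obtain ⟨k, D, hD⟩ := exists_width_eq_treewidth H
  -- pull the decomposition back along `f`: same tree, bags `f⁻¹(V_t)` (Diestel's `V_t ∩ V(H)`)
  let D' : TreeDecomposition G (Fin k) :=
    { tree := D.tree
      isTree := D.isTree
      bag := fun t => Finset.univ.filter fun v => f v ∈ D.bag t
      exists_mem_bag_of_adj := fun u v huv => by
        obtain ⟨t, hu, hv⟩ := D.exists_mem_bag_of_adj (f.map_adj huv)
        exact ⟨t, by simp [hu], by simp [hv]⟩
      connected_induce := fun v => by
        have : {t | v ∈ Finset.univ.filter fun v => f v ∈ D.bag t} = {t | f v ∈ D.bag t} := by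
          ext t; simp
        rw [this]
        exact D.connected_induce (f v) }
  have hcard : ∀ t, (D'.bag t).card ≤ (D.bag t).card := fun t => by
    refine Finset.card_le_card_of_injOn f (fun v hv => ?_) hf.injOn
    have hv' := Finset.mem_coe.1 hv
    simp only [D', Finset.mem_filter, Finset.mem_univ, true_and] at hv'
    exact Finset.mem_coe.2 hv'
  have hw : D'.width ≤ D.width :=
    D'.width_le fun t => (hcard t).trans (D.card_bag_le_width_add_one t)
  rw [← hD]
  exact (treewidth_le_width D').trans hw

/-! ### Brambles bound the treewidth from below -/

namespace TreeDecomposition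

variable {ι : Type*} (D : TreeDecomposition G ι)

/-- Two tree vertices whose bags contain `v` are joined by a tree walk along bags containing
`v` ((T3)). [folklore] -/
private theorem exists_walk_bags {v : V} {t₁ t₂ : ι} (h₁ : v ∈ D.bag t₁) (h₂ : v ∈ D.bag t₂) :
    ∃ W : D.tree.Walk t₁ t₂, ∀ s ∈ W.support, v ∈ D.bag s := by
  have hc := D.connected_induce v
  obtain ⟨W⟩ := hc.preconnected ⟨t₁, h₁⟩ ⟨t₂, h₂⟩
  exact exists_walk_of_induce_walk W

/-- Along a walk of `G` inside `B` the bags follow: tree vertices whose bags contain the ends are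
joined by a tree walk along bags meeting `B`. [folklore] -/
private theorem exists_walk_meets {B : Set V} {a b : V} (W : G.Walk a b) (hB : ∀ z ∈ W.support, z ∈ B)
    {t₁ t₂ : ι} (h₁ : a ∈ D.bag t₁) (h₂ : b ∈ D.bag t₂) :
    ∃ W' : D.tree.Walk t₁ t₂, ∀ s ∈ W'.support, ((D.bag s : Set V) ∩ B).Nonempty := by
  induction W generalizing t₁ with
  | nil =>
    rename_i a
    obtain ⟨W', hW'⟩ := D.exists_walk_bags h₁ h₂
    exact ⟨W', fun s hs => ⟨a, Finset.mem_coe.2 (hW' s hs), hB a (by simp)⟩⟩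
  | cons h W ih =>
    rename_i a c b
    have ha : a ∈ B := hB a (by simp)
    have hB' : ∀ z ∈ W.support, z ∈ B := fun z hz => hB z (by simp [hz])
    obtain ⟨t', hat', hct'⟩ := D.exists_mem_bag_of_adj h
    obtain ⟨W₁, hW₁⟩ := D.exists_walk_bags h₁ hat'
    obtain ⟨W₂, hW₂⟩ := ih hB' hct' h₂
    refine ⟨W₁.append W₂, fun s hs => ?_⟩
    rw [Walk.mem_support_append_iff] at hs
    rcases hs with hs | hs
    · exact ⟨a, Finset.mem_coe.2 (hW₁ s hs), ha⟩
    · exact hW₂ s hs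

/-- For a connected vertex set `B` of `G`, the tree vertices whose bags meet `B` form a connected
vertex set (the subtree `T_B := ∪{T_v : v ∈ V(B)}`) of the decomposition tree. [folklore] -/
private theorem isConnectedSet_meets {B : Set V} (hB : IsConnectedSet G B) :
    IsConnectedSet D.tree {t | ((D.bag t : Set V) ∩ B).Nonempty} := by
  obtain ⟨⟨v, hv⟩, hconn⟩ := hB
  obtain ⟨t, ht⟩ := D.exists_mem_bag v
  refine ⟨⟨t, ⟨v, Finset.mem_coe.2 ht, hv⟩⟩, fun t₁ h₁ t₂ h₂ => ?_⟩
  obtain ⟨a, ha, haB⟩ := h₁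
  obtain ⟨b, hb, hbB⟩ := h₂
  obtain ⟨W, hW⟩ := hconn haB hbB
  exact D.exists_walk_meets W hW (Finset.mem_coe.1 ha) (Finset.mem_coe.1 hb)

/-- Touching vertex sets meet a common bag. [folklore] -/
private theorem exists_meets_of_touches {B B' : Set V} (h : Touches G B B') :
    ({t | ((D.bag t : Set V) ∩ B).Nonempty} ∩ {t | ((D.bag t : Set V) ∩ B').Nonempty}).Nonempty := by
  rcases h with ⟨z, hz, hz'⟩ | ⟨x, hx, y, hy, hxy⟩
  · obtain ⟨t, ht⟩ := D.exists_mem_bag z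
    exact ⟨t, ⟨z, Finset.mem_coe.2 ht, hz⟩, ⟨z, Finset.mem_coe.2 ht, hz'⟩⟩
  · obtain ⟨t, hxt, hyt⟩ := D.exists_mem_bag_of_adj hxy
    exact ⟨t, ⟨x, Finset.mem_coe.2 hxt, hx⟩, ⟨y, Finset.mem_coe.2 hyt, hy⟩⟩

/-- **Every bramble is covered by some bag** of any tree decomposition (“if every two sets in `𝒞`
touch, we can find a `t ∈ T` such that `V_t` covers `𝒞`”; by the Helly property of subtrees,
`IsTree.helly`). [cite: Diestel2010, Thm 12.3.6 (remark before it; §12.3 Exercise 17)] -/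
theorem exists_bag_covers [Finite V] {ℬ : Set (Set V)} (hℬ : IsBramble G ℬ) (hne : ℬ.Nonempty) :
    ∃ t, Covers (D.bag t : Set V) ℬ := by
  haveI : Finite ℬ := inferInstance
  haveI : Nonempty ℬ := hne.to_subtype
  have hH := IsTree.helly D.isTree (fun B : ℬ => {t | ((D.bag t : Set V) ∩ (B : Set V)).Nonempty})
    (fun B => D.isConnectedSet_meets (hℬ.isConnectedSet B.2))
    (fun B B' => D.exists_meets_of_touches (hℬ.touches B.2 B'.2))
  obtain ⟨t, ht⟩ := hH
  refine ⟨t, fun B hB => ?_⟩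
  have := Set.mem_iInter.1 ht ⟨B, hB⟩
  simp only [Set.mem_setOf_eq] at this
  rwa [Set.inter_comm] at this

end TreeDecomposition

/-- **Brambles bound the tree-width from below** (the easy direction of Seymour–Thomas's
duality theorem, converse of `exists_isBramble_of_le_treewidth`): if `ℬ` is a bramble of the
finite graph `G` that no set of at most `k` vertices covers, then `k ≤ tw(G)` (some bag covers `ℬ`,
so it has more than `k` vertices). [cite: Diestel2010, Thm 12.3.6 (easy direction)] -/
theorem le_treewidth_of_isBramble [Fintype V] {ℬ : Set (Set V)} (hℬ : IsBramble G ℬ) {k : ℕ}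
    (hk : ∀ X : Set V, X.encard ≤ k → ¬ Covers X ℬ) : k ≤ treewidth G := by
  have hne : ℬ.Nonempty := by
    by_contra h
    rw [Set.not_nonempty_iff_eq_empty] at h
    exact hk ∅ (by simp) (by rw [h]; intro B hB; exact hB.elim)
  obtain ⟨m, D, hD⟩ := exists_width_eq_treewidth G
  obtain ⟨t, ht⟩ := D.exists_bag_covers hℬ hne
  by_contra hlt
  refine hk (D.bag t : Set V) ?_ ht
  have h1 := D.card_bag_le_width_add_one t
  rw [Set.encard_coe_eq_coe_finsetCard]
  exact_mod_cast (by omega : (D.bag t).card ≤ k)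

/-! ### The treewidth of the grid -/

section Grid

variable {a b : ℕ}

/-- Lifting a walk of the second factor to a box product with fixed first coordinate, keeping
track of the support. [folklore] -/
private theorem exists_walk_boxProd_right {α β : Type*} (G₁ : _root_.SimpleGraph α) (G₂ : _root_.SimpleGraph β)
    (x : α) : ∀ {y y' : β} (W : G₂.Walk y y'),
      ∃ W' : (G₁ □ G₂).Walk (x, y) (x, y'), ∀ p ∈ W'.support, p.1 = x
  | y, _, Walk.nil => ⟨Walk.nil, by simp⟩
  | y, y', Walk.cons (v := c) h W => by
    obtain ⟨W', hW'⟩ := exists_walk_boxProd_right G₁ G₂ x W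
    have hadj : (G₁ □ G₂).Adj (x, y) (x, c) := by
      rw [boxProd_adj]; exact Or.inr ⟨h, rfl⟩
    exact ⟨Walk.cons hadj W', fun p hp => by
      rw [Walk.support_cons, List.mem_cons] at hp
      rcases hp with rfl | hp
      · rfl
      · exact hW' p hp⟩

/-- Lifting a walk of the first factor to a box product with fixed second coordinate. [folklore] -/
private theorem exists_walk_boxProd_left {α β : Type*} (G₁ : _root_.SimpleGraph α) (G₂ : _root_.SimpleGraph β)
    (y : β) : ∀ {x x' : α} (W : G₁.Walk x x'),
      ∃ W' : (G₁ □ G₂).Walk (x, y) (x', y), ∀ p ∈ W'.support, p.2 = y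
  | x, _, Walk.nil => ⟨Walk.nil, by simp⟩
  | x, x', Walk.cons (v := c) h W => by
    obtain ⟨W', hW'⟩ := exists_walk_boxProd_left G₁ G₂ y W
    have hadj : (G₁ □ G₂).Adj (x, y) (c, y) := by
      rw [boxProd_adj]; exact Or.inl ⟨h, rfl⟩
    exact ⟨Walk.cons hadj W', fun p hp => by
      rw [Walk.support_cons, List.mem_cons] at hp
      rcases hp with rfl | hp
      · rfl
      · exact hW' p hp⟩

/-- Every vertex of a cross is joined to its centre inside the cross. [folklore] -/
private theorem exists_walk_to_centre (i : Fin (a + 1)) (j : Fin (b + 1)) {p : Fin (a + 1) × Fin (b + 1)}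
    (hp : p ∈ {p : Fin (a + 1) × Fin (b + 1) | p.1 = i ∨ p.2 = j}) :
    ∃ W : (grid a b).Walk p (i, j), ∀ q ∈ W.support, q ∈ {p : Fin (a + 1) × Fin (b + 1) | p.1 = i ∨ p.2 = j} := by
  obtain ⟨x, y⟩ := p
  rcases hp with h | h
  · -- along row `i`
    simp only at h
    subst h
    obtain ⟨W₂⟩ := (pathGraph_connected b).preconnected y j
    obtain ⟨W, hW⟩ := exists_walk_boxProd_right (pathGraph (a + 1)) (pathGraph (b + 1)) x W₂
    exact ⟨W, fun q hq => Or.inl (hW q hq)⟩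
  · simp only at h
    subst h
    obtain ⟨W₁⟩ := (pathGraph_connected a).preconnected x i
    obtain ⟨W, hW⟩ := exists_walk_boxProd_left (pathGraph (a + 1)) (pathGraph (b + 1)) y W₁
    exact ⟨W, fun q hq => Or.inr (hW q hq)⟩

/-- Crosses are connected vertex sets of the grid. [folklore] -/
private theorem isConnectedSet_cross (i : Fin (a + 1)) (j : Fin (b + 1)) :
    IsConnectedSet (grid a b) ({p : Fin (a + 1) × Fin (b + 1) | p.1 = i ∨ p.2 = j}) := by
  refine ⟨⟨(i, j), Or.inl rfl⟩, fun p hp q hq => ?_⟩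
  obtain ⟨W₁, hW₁⟩ := exists_walk_to_centre i j hp
  obtain ⟨W₂, hW₂⟩ := exists_walk_to_centre i j hq
  refine ⟨W₁.append W₂.reverse, fun z hz => ?_⟩
  rw [Walk.mem_support_append_iff, Walk.support_reverse, List.mem_reverse] at hz
  rcases hz with hz | hz
  · exact hW₁ z hz
  · exact hW₂ z hz

/-- Any two crosses share a vertex. [folklore] -/
private theorem touches_cross (i i' : Fin (a + 1)) (j j' : Fin (b + 1)) :
    Touches (grid a b) ({p : Fin (a + 1) × Fin (b + 1) | p.1 = i ∨ p.2 = j}) ({p : Fin (a + 1) × Fin (b + 1) | p.1 = i' ∨ p.2 = j'}) :=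
  Or.inl ⟨(i, j'), Or.inl rfl, Or.inr rfl⟩

/-- **The crosses form a bramble** of the grid. [cite: BondyMurty2008, §10.5 (Fig. 10.30)] -/
theorem isBramble_crosses (a b : ℕ) :
    IsBramble (grid a b) (Set.range fun ij : Fin (a + 1) × Fin (b + 1) =>
      {p : Fin (a + 1) × Fin (b + 1) | p.1 = ij.1 ∨ p.2 = ij.2}) where
  isConnectedSet := by
    rintro B ⟨⟨i, j⟩, rfl⟩
    exact isConnectedSet_cross i j
  touches := by
    rintro B ⟨⟨i, j⟩, rfl⟩ B' ⟨⟨i', j'⟩, rfl⟩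
    exact touches_cross i i' j j'

/-- A set of at most `min a b` vertices misses some cross: it misses a row and a column.
[folklore] -/
private theorem exists_cross_disjoint (X : Set (Fin (a + 1) × Fin (b + 1))) (hX : X.encard ≤ min a b) :
    ∃ i j, Disjoint ({p : Fin (a + 1) × Fin (b + 1) | p.1 = i ∨ p.2 = j}) X := by
  classical
  have hfin : X.Finite := Set.finite_of_encard_le_coe hX
  obtain ⟨Xf, rfl⟩ : ∃ Xf : Finset (Fin (a + 1) × Fin (b + 1)), X = ↑Xf := ⟨hfin.toFinset, by simp⟩
  rw [Set.encard_coe_eq_coe_finsetCard] at hX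
  have hX' : Xf.card ≤ min a b := by exact_mod_cast hX
  -- a row not hit
  have hrow : ∃ i : Fin (a + 1), i ∉ Xf.image Prod.fst := by
    by_contra h
    simp only [not_exists, not_not] at h
    have : (Finset.univ : Finset (Fin (a + 1))) ⊆ Xf.image Prod.fst := fun i _ => h i
    have h1 := Finset.card_le_card this
    have h2 := Finset.card_image_le (s := Xf) (f := Prod.fst)
    simp at h1
    omega
  have hcol : ∃ j : Fin (b + 1), j ∉ Xf.image Prod.snd := by
    by_contra h
    simp only [not_exists, not_not] at h
    have : (Finset.univ : Finset (Fin (b + 1))) ⊆ Xf.image Prod.snd := fun j _ => h j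
    have h1 := Finset.card_le_card this
    have h2 := Finset.card_image_le (s := Xf) (f := Prod.snd)
    simp at h1
    omega
  obtain ⟨i, hi⟩ := hrow
  obtain ⟨j, hj⟩ := hcol
  refine ⟨i, j, Set.disjoint_left.2 fun p hp hpX => ?_⟩
  have hpX' : p ∈ Xf := Finset.mem_coe.1 hpX
  rcases hp with h | h
  · exact hi (Finset.mem_image.2 ⟨p, hpX', h⟩)
  · exact hj (Finset.mem_image.2 ⟨p, hpX', h⟩)

/-- **The tree-width of the grid**: `min a b ≤ tw(grid a b)` for the `(a+1) × (b+1)` grid (the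
crosses are a bramble of order `> min a b`). [cite: BondyMurty2008, §10.5 (brambles of grids, Fig. 10.30; with Thm 12.3.6 of Diestel2010)] -/
theorem min_le_treewidth_grid (a b : ℕ) : min a b ≤ treewidth (grid a b) := by
  refine le_treewidth_of_isBramble (isBramble_crosses a b) fun X hX hcov => ?_
  obtain ⟨i, j, hij⟩ := exists_cross_disjoint X hX
  exact absurd (hcov (Set.mem_range.2 ⟨(i, j), rfl⟩)) (Set.not_nonempty_iff_eq_empty.2
    (Set.disjoint_iff_inter_eq_empty.1 hij))

end Grid

end Literature.Combinatorics.SimpleGraph
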